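import Literature.MathematicalPhysics.QuantumFieldTheory.Balaban1983to89.B9Eq342GreenPrimeTowerGradientRow
import Literature.MathematicalPhysics.QuantumFieldTheory.Balaban1983to89.B9Eq342GradientRowComparisonMassUniform

/-!
# `Balaban1983to89.B9Eq342GreenPrimeTowerGradientRowDiagonal` — T. Bałaban, *Propagators for lattice gauge theories in a background field*, Commun. Math.
# Phys. **99** (1985) 389–434 [Balaban1985BackgroundPropagators] Thm 3.1 (3.42) p. 397, SECOND ENTRY («δ₀, B₀ dependent on d and L only»), FOR PRINT's
# `G′_k(U)` — **THE GRADIENT ROW OF `B9Eq342GreenPrimeTowerGradientRow` READ ON PRINT's DIAGONAL `ηL^{n+1} = 1`, `c₀(L^{n+1})^d = c₁` WITH EVERY CONSTANT FREE OF THE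
# HEIGHT: in the small-gauge model `‖U(b) − 1‖ ≤ αη`, `‖U(x,μ) − U(x−e_μ,μ)‖ ≤ α′η²` ((3.35) in the identity gauge at `L^jη = 1`), at site rate `a = κ₀η` and comparison
# mass `m_c ≥ 2` in the t-FREE windows `4d(cosh κ₀ − 1) ≤ m_c`, `2(2M_φM_φ′α)(e^{κ₀}+1)d(3√2 + 4 sinh κ₀) ≤ √m_c`, given the decayed value row at rate `κ ≤ κ₀`:
# `‖(∇^η_UG′_k(U)f)(b)‖ ≤ 2e^{κ₀}·2C₁·(1 + (|a′| + m_c)C_u + d(2M_φM_φ′α′ + (2M_φM_φ′α)²)C_u + (M_φM_φ′α·m_c∕κ₀)C_u)·F·e^{−κ·d_m(Πb₊,v)}`, `C₁ = (3√2 + 4 sinh κ₀)∕√m_c`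
# — a function of `(d, a′, M_φ, M_φ′, α, α′, κ₀, m_c, C_u)` alone: NO `n`, `L`, `η`, `m`, `c₀`, `c₁`**

statement-level skeleton of published theorems with citation tags; proofs where landed; nothing here is a claim about the Yang–Mills mass gap

CITATION HEADER (lean-in-tree rule).  Audit cell `pub-balaban`, sub-cell `t4`, BINDER row NE9; filed by the NE9 OWNER lineage `b2b-balaban-t4-ne9-p1` (gen 95).
SOURCE READ first-hand in the held text layer [Balaban1985BackgroundPropagators] (`paper:balaban1985-cmp99-background-propagators`): p. 396 (3.35) (the two sizes
`|A| < O(1)Mα₀(L^jη)⁻¹`, `|∇^ηA| < O(1)Mα₀(L^jη)⁻²`); p. 397 Thm 3.1 («B₀ dependent on d and L only») and (3.42); p. 398 («invariant with respect to gauge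
transformations of U»).  Print's random-walk proof is NOT reproduced (see the parent file's header); this file is [folklore] real arithmetic BY NAME over
ne9-leaf-05's (K37) `B9Eq342GradientRowComparisonMassUniform` (`window_of_tfree_window`, `mul_weighted_row_le_uniform`, `uniform_const_le_of_two_le`) and ne9-leaf-03's
`B9Eq324PenaltyBlockLocal.norm_laplacePrimeAk_sub_covLaplace_apply_le_block_diagonal` (`p₂ = |a′|∕√c₁`).  Nothing printed is a hypothesis except the model letters.

WHAT IS PROVED (sorry-free; proof lane — no `def`; [folklore]).  **`norm_covDeriv_GpOfUk_le_blockLetter_diagonal`** — the parent's §1 at `a := κ₀η`, `ε_U := αη`,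
`a_U := α′η²`, `p₂ := |a′|∕√c₁`, `β := 2 sinh a∕(m_c − 2dη⁻²(cosh a − 1))`, `κ′ := κ₀`, `C := C_W(m_c, κ₀, 1)`, `K := C√m_c`, then `η⁻¹·η = 1` (`|η⁻¹|·αη = α`,
`η⁻²·α′η² = α′`), `sinh a ≥ a` (`δ∕β ≤ M_φM_φ′α·m_c∕κ₀`), `η⁻¹·B_ν ≤ C_W ≤ C₁`, `e^{κ₀η(L^{n+1}−1)} ≤ e^{κ₀}`; `2 ≤ L`, `1 ≤ d` give `N_ν ≥ 2`, `N_ν ≥ η⁻¹`.  The one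
`set_option maxHeartbeats 400000` covers the size of the displayed closed form (as (K60) `B9Eq326LocalPartGradientRowsWindows`), not a search.
HONEST SCOPE.  DISPLAYED: the decayed value row (`C_u`, `κ ≤ κ₀`: T-A∕T-B∕T-D), (T) contractions of `U` and of its level averages (`hRlev` — inhabited from
`star U_j = U_j⁻¹` by `norm_adTransportW_eq`, NOT from `U_j ∈ U1` alone: ne9-leaf-03 g78 X-GTD (N1)), the (K1) family, the MODEL letters `U(b) ∈ U1`, `α`, `α′`
and the two t-free windows — NOT a smallness of `α` in substance (X-GTD (N2)): for EVERY `α` both hold with `m_c` large (`m_c ≥ max(2, 4d(cosh κ₀ − 1),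
(2(2M_φM_φ′α)(e^{κ₀}+1)d(3√2 + 4 sinh κ₀))²)`), at the price of the factor `m_c` inside the constant; `…GradientRowClosed` instead fixes `m_c` and caps `α`; the constant is crude; whether print's class (3.35)
admits the global small gauge is the model's matter («WALLED ON A MODEL»); nothing of [B9] Thm 3.1∕3.3∕3.11 is asserted, valued or discharged.  NOT summit progress
(cell pub-balaban: NE9 NOT PRINTED ∕ NOT PROVED; «NE9 ⇐ the named binders»; row WALLED ON A MODEL (O-NE9-1; #5 UNRULED); spine PROVED 0∕9; rung (B)+1 on a finite T⁴ —
NOT infinite volume, NOT mass gap, NOT BetaPertH, NOT Clay).  HONEST DEPENDENCY (cell line): continuum YM on T⁴ ⇐ BetaPertH ∧ nine spine estimates (0/9 proved);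
BetaPertH ⇐ (D1) ∧ (D4) ∧ CAP+tail; G-an2-4 gates asym, D1 and NE2/3/4.  NEW file; nothing modified.  Net new unproved facts: 0.
-/

noncomputable section

set_option autoImplicit false

open scoped BigOperators InnerProductSpace

namespace Literature.MathematicalPhysics.QuantumFieldTheory.Balaban1983to89.B9Eq342GreenPrimeTowerGradientRowDiagonal

open B4Sect5Torus (TSite tdist)
open B9SectCLatticeCarrier (Bond bpos btgt shift unshift)
open B4TorusKernel.MultiPeriod (circAbs)
open B9Eq311L2Pairing (WL2)
open B11Eq103H1Complex (SiteL2K covLaplaceSiteK covDerivL2K)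
open B9Eq310HessianOperator (adTransportW)
open B7Prop1Explicit (U1)
open B9Eq319QprimeTorus (fineP blockCoord)
open B9Eq315QTower (towerP)
open B9Eq316TowerFlatIsOneStep (towerP_eq_fineP_pow siteCast)
open B9Eq324DeltaPrimeATower (laplacePrimeAk GpOfUk)
open B9Eq342GreenPrimeTowerSupBoundDecay (bigBlock_eq_iff)
open B9Eq342GreenPrimeTowerGradientRow (norm_covDeriv_GpOfUk_le_blockLetter)

variable {d : ℕ} (L : ℕ) [NeZero L] (m : Fin d → ℕ) [∀ i, NeZero (m i)] (n : ℕ)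

/-! ## §1 On print's diagonal: every letter height-free -/

section Diagonal

open B9Eq315QTower (UlevOf towerP_apply)
open B9Eq342GradientRowComparisonMassUniform (window_of_tfree_window mul_weighted_row_le_uniform uniform_const_le_of_two_le)
open B9Eq324PenaltyBlockLocal (norm_laplacePrimeAk_sub_covLaplace_apply_le_block_diagonal)

/-- real bookkeeping: the bracket of §1 against t-free letters. [folklore] -/
private theorem bracket_le {t S S' δ β Cu B C₁ Q : ℝ} (hS : S ≤ S') (hQ : δ / β ≤ Q) (hCu : 0 ≤ Cu) (htB : t * B ≤ C₁)
    (htB0 : 0 ≤ t * B) (hY : 0 ≤ S' + Q * Cu) : 2 * (t * S + t * δ / β * Cu) * B ≤ 2 * C₁ * (S' + Q * Cu) := by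
  have e : 2 * (t * S + t * δ / β * Cu) * B = 2 * ((S + δ / β * Cu) * (t * B)) := by ring
  have h1 : S + δ / β * Cu ≤ S' + Q * Cu := add_le_add hS (mul_le_mul_of_nonneg_right hQ hCu)
  rw [e]
  have h2 := mul_le_mul h1 htB htB0 hY
  linarith

/-- real bookkeeping: monotonicity of the product `M·X·F·E`. [folklore] -/
private theorem assemble_le {M M' X X' F E : ℝ} (hM : M ≤ M') (hX : X ≤ X') (hX0 : 0 ≤ X) (hM' : 0 ≤ M') (hF : 0 ≤ F) (hE : 0 ≤ E) :
    M * X * F * E ≤ M' * X' * F * E :=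
  mul_le_mul_of_nonneg_right (mul_le_mul_of_nonneg_right (mul_le_mul hM hX hX0 hM') hF) hE

variable {𝔸 : Type*} [NormedRing 𝔸] [NormedAlgebra ℂ 𝔸] [CompleteSpace 𝔸] [NormOneClass 𝔸]
  {W : Type*} [NormedAddCommGroup W] [InnerProductSpace ℂ W] [FiniteDimensional ℂ W] (φ : W ≃ₗ[ℂ] 𝔸) {c₀ : ℝ} [Fact (0 < c₀)]
  {Mφ Mφ' : ℝ} (hφ : ∀ w, ‖φ w‖ ≤ Mφ * ‖w‖) (hφ' : ∀ X, ‖φ.symm X‖ ≤ Mφ' * ‖X‖) (hMφ : 0 ≤ Mφ) (hMφ' : 0 ≤ Mφ')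
  {η : ℝ} (U : Bond d (towerP L m (n + 1)) → 𝔸ˣ) {c₁ : ℝ} [Fact (0 < c₁)] (a' : ℝ)
  (hpos' : ∀ x : SiteL2K ℂ d (towerP L m (n + 1)) c₀ W, x ≠ 0 → 0 < RCLike.re ⟪x, laplacePrimeAk L m n φ η U a' (c₁ := c₁) x⟫_ℂ)
  (hU1 : ∀ b, U b ∈ U1 𝔸) {α α' : ℝ} (hα : 0 ≤ α) (hα' : 0 ≤ α') (hUη : ∀ b, ‖(U b : 𝔸) - 1‖ ≤ α * η)
  (hUa : ∀ (x : TSite d (towerP L m (n + 1))) (μ : Fin d), ‖(U (x, μ) : 𝔸) - (U (unshift μ x, μ) : 𝔸)‖ ≤ α' * η ^ 2)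
  {κ₀ mc : ℝ} (hκ₀ : 0 < κ₀) (hmc2 : 2 ≤ mc)

set_option maxHeartbeats 400000 in
include hφ hφ' hMφ hMφ' hU1 hα hα' hUη hUa hκ₀ hmc2 in
/-- **THE COVARIANT-GRADIENT ROW OF (3.42) FOR `G′_k(U)` ON PRINT's DIAGONAL — EVERY CONSTANT HEIGHT-FREE.**  On the diagonal `ηL^{n+1} = 1`,
`c₀(L^{n+1})^d = c₁` (`2 ≤ L`, `1 ≤ d`), for a background with unit-bounded bond variables, `‖U(b) − 1‖ ≤ αη` on every fine bond and the bond-gradient datum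
`‖U(x,μ) − U(x−e_μ,μ)‖ ≤ α′η²` (print's `|A| < O(1)Mα₀(L^jη)⁻¹`, `|∇^ηA| < O(1)Mα₀(L^jη)⁻²` of (3.35) read in the identity gauge at `L^jη = 1`), contractive
transporters of `U` and of its level averages (T), the (K1) big-block family `P_y`, a physical rate `κ₀ > 0` and a comparison mass `m_c ≥ 2` in the t-FREE windows
`4d(cosh κ₀ − 1) ≤ m_c`, `2·(2M_φM_φ′α)(e^{κ₀}+1)·d·(3√2 + 4 sinh κ₀) ≤ √m_c` (a smallness of `α` only), a source `f` supported in the big block `v` with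
`‖f‖_∞ ≤ F` and the decayed value row `‖(G′_k(U)f)(x)‖ ≤ C_u·F·e^{−κ·d_m(Πx,v)}` at a rate `0 ≤ κ ≤ κ₀` (DISPLAYED — T-A∕T-B∕T-D of this lineage):
`‖(∇^η_U G′_k(U)f)(b)‖ ≤ 2e^{κ₀}·(2·C₁·(1 + (|a′| + m_c)·C_u + d(2M_φM_φ′α′ + (2M_φM_φ′α)²)·C_u + (M_φM_φ′α·m_c∕κ₀)·C_u))·F·e^{−κ·d_m(Πb₊, v)}`,
`C₁ = (3√2 + 4 sinh κ₀)∕√m_c` — a function of `(d, a′, M_φ, M_φ′, α, α′, κ₀, m_c, C_u)` ALONE: no `n`, `L`, `η`, `m`, `c₀`, `c₁`.  §1 at `a := κ₀η`,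
`ε_U := αη`, `a_U := α′η²`, `p₂ := |a′|∕√c₁` (ne9-leaf-03's `norm_laplacePrimeAk_sub_covLaplace_apply_le_block_diagonal`), `β := 2 sinh a∕(m_c − 2dη⁻²(cosh a − 1))`,
`κ′ := κ₀`, `C := C_W(m_c, κ₀, 1)`, `K := C·√m_c` ((K37) `mul_weighted_row_le_uniform`, `uniform_const_le_of_two_le`, `window_of_tfree_window`), then
`η⁻¹·η = 1`, `sinh a ≥ a`, `e^{κ₀η(L^{n+1}−1)} ≤ e^{κ₀}`. [cite: Balaban1985BackgroundPropagators, Thm 3.1 (3.42) p.397 («B₀ dependent on d and L only»), (3.35) p.396, (3.49) p.399] -/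
theorem norm_covDeriv_GpOfUk_le_blockLetter_diagonal (hd : 1 ≤ d) (hL2 : 2 ≤ L)
    (hηL : η * (L : ℝ) ^ (n + 1) = 1) (hw : c₀ * ((L : ℝ) ^ (n + 1)) ^ d = c₁)
    (hR : ∀ (b : Bond d (towerP L m (n + 1))) (w : W), ‖adTransportW φ U b w‖ ≤ ‖w‖)
    (hS : ∀ (b : Bond d (towerP L m (n + 1))) (w : W), ‖adTransportW φ (fun bb => (U bb)⁻¹) b w‖ ≤ ‖w‖)
    (hRlev : ∀ j b w, ‖adTransportW φ (UlevOf L m (n + 1) U j) b w‖ ≤ ‖w‖)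
    {PS : TSite d m → SiteL2K ℂ d (towerP L m (n + 1)) c₀ W →L[ℂ] SiteL2K ℂ d (towerP L m (n + 1)) c₀ W}
    (hPS : ∀ (y : TSite d m) (g : SiteL2K ℂ d (towerP L m (n + 1)) c₀ W) (x : TSite d (towerP L m (n + 1))),
      WL2.equiv ℂ (fun _ : TSite d (towerP L m (n + 1)) => c₀) W (PS y g) x =
        if blockCoord (L ^ (n + 1)) m (siteCast (towerP_eq_fineP_pow L m (n + 1)) x) = y then
          WL2.equiv ℂ (fun _ : TSite d (towerP L m (n + 1)) => c₀) W g x else 0)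
    (hwin4 : 4 * (d : ℝ) * (Real.cosh κ₀ - 1) ≤ mc)
    (hsmall : 2 * ((2 * Mφ * Mφ' * α) * (Real.exp κ₀ + 1) * (d : ℝ) * ((1 + 2 / 1) * Real.sqrt 2 + 4 * Real.sinh κ₀)) ≤ Real.sqrt mc)
    (v : TSite d m) (f : SiteL2K ℂ d (towerP L m (n + 1)) c₀ W) {F Cu κ : ℝ} (hF : 0 ≤ F) (hCu : 0 ≤ Cu) (hκ : 0 ≤ κ) (hκ0 : κ ≤ κ₀)
    (hfv : ∀ x, blockCoord (L ^ (n + 1)) m (siteCast (towerP_eq_fineP_pow L m (n + 1)) x) ≠ v →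
      WL2.equiv ℂ (fun _ : TSite d (towerP L m (n + 1)) => c₀) W f x = 0)
    (hfF : ∀ x, ‖WL2.equiv ℂ (fun _ : TSite d (towerP L m (n + 1)) => c₀) W f x‖ ≤ F)
    (hudec : ∀ x, ‖WL2.equiv ℂ (fun _ : TSite d (towerP L m (n + 1)) => c₀) W (GpOfUk L m n φ η U a' hpos' f) x‖ ≤
      Cu * F * Real.exp (-(κ * tdist m (blockCoord (L ^ (n + 1)) m (siteCast (towerP_eq_fineP_pow L m (n + 1)) x)) v)))
    (bnd : Bond d (towerP L m (n + 1))) :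
    ‖WL2.equiv ℂ (fun _ : Bond d (towerP L m (n + 1)) => c₀) W
        (covDerivL2K ℂ c₀ ((η : ℂ))⁻¹ (adTransportW φ U) (GpOfUk L m n φ η U a' hpos' f)) bnd‖ ≤
      2 * Real.exp κ₀ *
        (2 * (((1 + 2 / 1) * Real.sqrt 2 + 4 * Real.sinh κ₀) / Real.sqrt mc) *
          (1 + (|a'| + mc) * Cu + (d : ℝ) * (2 * Mφ * Mφ' * α' + (2 * Mφ * Mφ' * α) * (2 * Mφ * Mφ' * α)) * Cu +
            (Mφ * Mφ' * α * mc / κ₀) * Cu)) *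
        F * Real.exp (-(κ * tdist m (blockCoord (L ^ (n + 1)) m (siteCast (towerP_eq_fineP_pow L m (n + 1)) (btgt bnd))) v)) := by
  have hm1 : ∀ i, 1 ≤ m i := fun i => Nat.one_le_iff_ne_zero.mpr (NeZero.ne (m i))
  have hc1 : (0 : ℝ) < c₁ := Fact.out
  have hmc : 0 < mc := by linarith
  have hsm : 0 < Real.sqrt mc := Real.sqrt_pos.2 hmc
  -- the units on the diagonal: `η⁻¹ = L^{n+1} ≥ 1`, `η ≤ 1`
  have hL1 : (1 : ℝ) ≤ (L : ℝ) := by exact_mod_cast le_trans (by norm_num) hL2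
  have hLpow : (1 : ℝ) ≤ (L : ℝ) ^ (n + 1) := one_le_pow₀ hL1
  have hinv : η⁻¹ = (L : ℝ) ^ (n + 1) := inv_eq_of_mul_eq_one_right hηL
  have ht1 : (1 : ℝ) ≤ η⁻¹ := by rw [hinv]; exact hLpow
  have ht0 : (0 : ℝ) < η⁻¹ := by linarith
  have hη : 0 < η := inv_pos.mp ht0
  have hη1 : η ≤ 1 := by
    have h := mul_le_mul_of_nonneg_left hLpow hη.le
    rw [mul_one, hηL] at h
    exact h
  have hηη : η⁻¹ * η = 1 := inv_mul_cancel₀ hη.ne'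
  have habs : |η⁻¹| = η⁻¹ := abs_of_pos ht0
  have hnorm : ‖((η⁻¹ : ℝ) : ℂ)‖ = η⁻¹ := by rw [Complex.norm_real, Real.norm_eq_abs, habs]
  have hnmc : ‖((mc : ℝ) : ℂ)‖ = mc := by rw [Complex.norm_real, Real.norm_eq_abs, abs_of_pos hmc]
  -- the site rate `a = κ₀η`: block rate `aL^{n+1} = κ₀`, `a ≤ κ₀`
  have ha : 0 ≤ κ₀ * η := mul_nonneg hκ₀.le hη.le
  have hapos : 0 < κ₀ * η := mul_pos hκ₀ hη
  have haL : κ₀ * η * (L : ℝ) ^ (n + 1) = κ₀ := by rw [mul_assoc, hηL, mul_one]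
  have hκa : κ ≤ κ₀ * η * (L : ℝ) ^ (n + 1) := by rw [haL]; exact hκ0
  have haκ : κ₀ * η ≤ κ₀ := mul_le_of_le_one_right hκ₀.le hη1
  have hdiv : κ₀ / η⁻¹ = κ₀ * η := div_inv_eq_mul κ₀ η
  -- the `cosh` window from the t-free window
  have hlam4 := window_of_tfree_window ht1 hκ₀.le d hwin4
  rw [hdiv] at hlam4
  have hch : 0 ≤ Real.cosh (κ₀ * η) - 1 := by linarith [Real.one_le_cosh (κ₀ * η)]
  have hX0' : 0 ≤ (d : ℝ) * (η⁻¹ ^ 2 * (Real.cosh (κ₀ * η) - 1)) := by positivity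
  have hX1 : 0 ≤ η⁻¹ ^ 2 * (Real.cosh (κ₀ * η) - 1) := by positivity
  have eX : 2 * (d : ℝ) * η⁻¹ ^ 2 * (Real.cosh (κ₀ * η) - 1) = 2 * ((d : ℝ) * (η⁻¹ ^ 2 * (Real.cosh (κ₀ * η) - 1))) := by ring
  have eX4 : 4 * (d : ℝ) * (η⁻¹ ^ 2 * (Real.cosh (κ₀ * η) - 1)) = 4 * ((d : ℝ) * (η⁻¹ ^ 2 * (Real.cosh (κ₀ * η) - 1))) := by ring
  rw [eX4] at hlam4
  have hlam : 2 * (d : ℝ) * η⁻¹ ^ 2 * (Real.cosh (κ₀ * η) - 1) < mc := by rw [eX]; linarith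
  have hm'' : 0 < mc - 2 * (d : ℝ) * η⁻¹ ^ 2 * (Real.cosh (κ₀ * η) - 1) := by linarith
  have hm''le : mc - 2 * (d : ℝ) * η⁻¹ ^ 2 * (Real.cosh (κ₀ * η) - 1) ≤ mc := by rw [eX]; linarith
  have hm' : 0 < mc - 2 * ((d : ℝ) - 1) * η⁻¹ ^ 2 * (Real.cosh (κ₀ * η) - 1) := by
    have e : 2 * ((d : ℝ) - 1) * η⁻¹ ^ 2 * (Real.cosh (κ₀ * η) - 1) =
        2 * ((d : ℝ) * (η⁻¹ ^ 2 * (Real.cosh (κ₀ * η) - 1))) - 2 * (η⁻¹ ^ 2 * (Real.cosh (κ₀ * η) - 1)) := by ring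
    rw [e]; linarith
  -- the torus sides `N_ν = L^{n+1}m_ν ≥ max(2, η⁻¹)`
  have hN : ∀ ν, (towerP L m (n + 1) ν : ℝ) = (L : ℝ) ^ (n + 1) * (m ν : ℝ) := fun ν => by
    rw [towerP_apply]; push_cast; ring
  have hn : ∀ ν, 2 ≤ towerP L m (n + 1) ν := fun ν => by
    rw [towerP_apply]
    calc 2 = 2 ^ 1 * 1 := by norm_num
      _ ≤ L ^ (n + 1) * m ν := Nat.mul_le_mul (le_trans (Nat.pow_le_pow_right (by norm_num) (Nat.le_add_left 1 n)) (Nat.pow_le_pow_left hL2 _)) (hm1 ν)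
  have hLn : ∀ ν : Fin d, (1 : ℝ) * η⁻¹ ≤ (towerP L m (n + 1) ν : ℝ) := fun ν => by
    rw [one_mul, hinv, hN ν]
    have h1 : (1 : ℝ) ≤ (m ν : ℝ) := by exact_mod_cast hm1 ν
    have h0 : (0 : ℝ) ≤ (L : ℝ) ^ (n + 1) := by positivity
    calc (L : ℝ) ^ (n + 1) = (L : ℝ) ^ (n + 1) * 1 := (mul_one _).symm
      _ ≤ (L : ℝ) ^ (n + 1) * (m ν : ℝ) := mul_le_mul_of_nonneg_left h1 h0
  -- the direction constant's positive floor `β := 2 sinh a∕(m_c − 2dη⁻²(cosh a − 1))` and the t-free row gain `C_W`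
  have hsinh : 0 < Real.sinh (κ₀ * η) := Real.sinh_pos_iff.mpr hapos
  have hβ : 0 < 2 * Real.sinh (κ₀ * η) / (mc - 2 * (d : ℝ) * η⁻¹ ^ 2 * (Real.cosh (κ₀ * η) - 1)) := by positivity
  have hfirst : ∀ ν : Fin d, 0 ≤ (1 + Real.exp (-(κ₀ * η))) *
      ((1 + 2 * η⁻¹ / (towerP L m (n + 1) ν * Real.sqrt (mc - 2 * ((d : ℝ) - 1) * η⁻¹ ^ 2 * (Real.cosh (κ₀ * η) - 1)))) /
        Real.sqrt ((mc - 2 * ((d : ℝ) - 1) * η⁻¹ ^ 2 * (Real.cosh (κ₀ * η) - 1)) ^ 2 +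
          4 * (mc - 2 * ((d : ℝ) - 1) * η⁻¹ ^ 2 * (Real.cosh (κ₀ * η) - 1)) * η⁻¹ ^ 2)) := fun ν => by positivity
  have hβB : ∀ ν : Fin d, 2 * Real.sinh (κ₀ * η) / (mc - 2 * (d : ℝ) * η⁻¹ ^ 2 * (Real.cosh (κ₀ * η) - 1)) ≤
      (fun ν : Fin d => (1 + Real.exp (-(κ₀ * η))) *
        ((1 + 2 * η⁻¹ / (towerP L m (n + 1) ν * Real.sqrt (mc - 2 * ((d : ℝ) - 1) * η⁻¹ ^ 2 * (Real.cosh (κ₀ * η) - 1)))) /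
          Real.sqrt ((mc - 2 * ((d : ℝ) - 1) * η⁻¹ ^ 2 * (Real.cosh (κ₀ * η) - 1)) ^ 2 +
            4 * (mc - 2 * ((d : ℝ) - 1) * η⁻¹ ^ 2 * (Real.cosh (κ₀ * η) - 1)) * η⁻¹ ^ 2)) +
        2 * Real.sinh (κ₀ * η) / (mc - 2 * (d : ℝ) * η⁻¹ ^ 2 * (Real.cosh (κ₀ * η) - 1))) ν :=
    fun ν => le_add_of_nonneg_left (hfirst ν)
  have hCW : 0 ≤ (1 + 2 / (1 * Real.sqrt (mc / 2))) / Real.sqrt (mc / 2) + 4 * Real.sinh κ₀ / mc := by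
    have hs : 0 ≤ Real.sinh κ₀ := Real.sinh_nonneg_iff.2 hκ₀.le
    positivity
  have htB : ∀ ν, ‖((η⁻¹ : ℝ) : ℂ)‖ * (fun ν : Fin d => (1 + Real.exp (-(κ₀ * η))) *
        ((1 + 2 * η⁻¹ / (towerP L m (n + 1) ν * Real.sqrt (mc - 2 * ((d : ℝ) - 1) * η⁻¹ ^ 2 * (Real.cosh (κ₀ * η) - 1)))) /
          Real.sqrt ((mc - 2 * ((d : ℝ) - 1) * η⁻¹ ^ 2 * (Real.cosh (κ₀ * η) - 1)) ^ 2 +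
            4 * (mc - 2 * ((d : ℝ) - 1) * η⁻¹ ^ 2 * (Real.cosh (κ₀ * η) - 1)) * η⁻¹ ^ 2)) +
        2 * Real.sinh (κ₀ * η) / (mc - 2 * (d : ℝ) * η⁻¹ ^ 2 * (Real.cosh (κ₀ * η) - 1))) ν ≤
      (1 + 2 / (1 * Real.sqrt (mc / 2))) / Real.sqrt (mc / 2) + 4 * Real.sinh κ₀ / mc := fun ν => by
    have h := mul_weighted_row_le_uniform η⁻¹ ht1 (m := mc) (κ := κ₀) (n := (towerP L m (n + 1) ν : ℝ)) (L := 1) hmc hκ₀.le one_pos (hLn ν) d hwin4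
    rw [hdiv] at h
    rw [hnorm]
    exact h
  have hCle := uniform_const_le_of_two_le (κ := κ₀) (L := (1 : ℝ)) hmc2 hκ₀.le one_pos
  have hCK : (1 + 2 / (1 * Real.sqrt (mc / 2))) / Real.sqrt (mc / 2) + 4 * Real.sinh κ₀ / mc ≤
      ((1 + 2 / (1 * Real.sqrt (mc / 2))) / Real.sqrt (mc / 2) + 4 * Real.sinh κ₀ / mc) * Real.sqrt mc / Real.sqrt mc :=
    (mul_div_cancel_right₀ _ hsm.ne').symm.le
  -- the model letters in units of `η`: `|η⁻¹|·(αη) = α`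
  have hte : |η⁻¹| * (2 * Mφ * Mφ' * (α * η)) = 2 * Mφ * Mφ' * α := by
    rw [habs]
    calc η⁻¹ * (2 * Mφ * Mφ' * (α * η)) = 2 * Mφ * Mφ' * α * (η⁻¹ * η) := by ring
      _ = 2 * Mφ * Mφ' * α := by rw [hηη, mul_one]
  have hmK : 2 * ((|η⁻¹| * (2 * Mφ * Mφ' * (α * η))) * (Real.exp κ₀ + 1) * (d : ℝ) *
      (((1 + 2 / (1 * Real.sqrt (mc / 2))) / Real.sqrt (mc / 2) + 4 * Real.sinh κ₀ / mc) * Real.sqrt mc)) ≤ Real.sqrt mc := by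
    rw [hte]
    have hb0 : 0 ≤ (2 * Mφ * Mφ' * α) * (Real.exp κ₀ + 1) * (d : ℝ) := by positivity
    calc 2 * ((2 * Mφ * Mφ' * α) * (Real.exp κ₀ + 1) * (d : ℝ) *
          (((1 + 2 / (1 * Real.sqrt (mc / 2))) / Real.sqrt (mc / 2) + 4 * Real.sinh κ₀ / mc) * Real.sqrt mc))
        = 2 * ((2 * Mφ * Mφ' * α) * (Real.exp κ₀ + 1) * (d : ℝ)) *
            (((1 + 2 / (1 * Real.sqrt (mc / 2))) / Real.sqrt (mc / 2) + 4 * Real.sinh κ₀ / mc) * Real.sqrt mc) := by ring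
      _ ≤ 2 * ((2 * Mφ * Mφ' * α) * (Real.exp κ₀ + 1) * (d : ℝ)) *
            (((1 + 2 / 1) * Real.sqrt 2 + 4 * Real.sinh κ₀) / Real.sqrt mc * Real.sqrt mc) :=
          mul_le_mul_of_nonneg_left (mul_le_mul_of_nonneg_right hCle hsm.le) (by positivity)
      _ = 2 * ((2 * Mφ * Mφ' * α) * (Real.exp κ₀ + 1) * (d : ℝ) * ((1 + 2 / 1) * Real.sqrt 2 + 4 * Real.sinh κ₀)) := by
          rw [div_mul_cancel₀ _ hsm.ne']; ring
      _ ≤ Real.sqrt mc := hsmall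
  -- (D-P)k with `p₂ = |a′|∕√c₁`
  have hPS' : ∀ (y : TSite d m) (g : SiteL2K ℂ d (towerP L m (n + 1)) c₀ W) (x : TSite d (towerP L m (n + 1))),
      WL2.equiv ℂ (fun _ : TSite d (towerP L m (n + 1)) => c₀) W (PS y g) x =
        if (∀ i, (x i : ℕ) / L ^ (n + 1) = (y i : ℕ)) then WL2.equiv ℂ (fun _ : TSite d (towerP L m (n + 1)) => c₀) W g x else 0 :=
    fun y g x => by rw [hPS]; exact if_congr (bigBlock_eq_iff L m n x y) rfl rfl
  have hP : ∀ (w : SiteL2K ℂ d (towerP L m (n + 1)) c₀ W) (x : TSite d (towerP L m (n + 1))),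
      ‖WL2.equiv ℂ _ W (laplacePrimeAk L m n φ η U a' (c₁ := c₁) w -
        covLaplaceSiteK ((η : ℂ))⁻¹ (adTransportW φ U) (adTransportW φ fun bb => (U bb)⁻¹) w) x‖ ≤
        |a'| * (Real.sqrt c₁)⁻¹ * ‖PS (blockCoord (L ^ (n + 1)) m (siteCast (towerP_eq_fineP_pow L m (n + 1)) x)) w‖ := fun w x =>
    norm_laplacePrimeAk_sub_covLaplace_apply_le_block_diagonal L m n φ U (hP := hPS') (hRlev := hRlev) hw η a' w x _
      ((bigBlock_eq_iff L m n x _).1 rfl)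
  -- §1 at the diagonal choices
  have hmain := norm_covDeriv_GpOfUk_le_blockLetter L m n φ hφ hφ' hMφ hMφ' hη U a' hpos' hU1 (by positivity) (by positivity) hUη hUa
    (κ₀ * η) mc ha hmc hlam hn hR hS hPS (by positivity) hP v f hF hCu hκ hκa hfv hfF hudec hβ hβB haκ hCW htB hCK hmK bnd
  -- read the letters: `p₂√(c₀L^{(n+1)d}) = |a′|`, `η⁻²(α′η²) = α′`, `(η⁻¹αη)² = α²`, `δ∕β ≤ M_φM_φ′α·m_c∕κ₀`, `η⁻¹B_ν ≤ C₁`, `e^{a(L^{n+1}−1)} ≤ e^{κ₀}`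
  have e2 : |a'| * (Real.sqrt c₁)⁻¹ * Real.sqrt (c₀ * ((L : ℝ) ^ (n + 1)) ^ d) = |a'| := by
    rw [hw, mul_assoc, inv_mul_cancel₀ (Real.sqrt_pos.2 hc1).ne', mul_one]
  have e4 : (d : ℝ) * (η⁻¹ ^ 2 * (2 * Mφ * Mφ' * (α' * η ^ 2) + 2 * Mφ * Mφ' * (α * η) * (2 * Mφ * Mφ' * (α * η)))) =
      (d : ℝ) * (2 * Mφ * Mφ' * α' + (2 * Mφ * Mφ' * α) * (2 * Mφ * Mφ' * α)) := by
    have e : η⁻¹ ^ 2 * (2 * Mφ * Mφ' * (α' * η ^ 2) + 2 * Mφ * Mφ' * (α * η) * (2 * Mφ * Mφ' * (α * η))) =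
        (2 * Mφ * Mφ' * α' + (2 * Mφ * Mφ' * α) * (2 * Mφ * Mφ' * α)) * (η⁻¹ * η) ^ 2 := by ring
    rw [e, hηη, one_pow, mul_one]
  have hδβ : 2 * Mφ * Mφ' * (α * η) / (2 * Real.sinh (κ₀ * η) / (mc - 2 * (d : ℝ) * η⁻¹ ^ 2 * (Real.cosh (κ₀ * η) - 1))) ≤
      Mφ * Mφ' * α * mc / κ₀ := by
    have hsa : κ₀ * η ≤ Real.sinh (κ₀ * η) := Real.self_le_sinh_iff.mpr hapos.le
    rw [div_div_eq_mul_div]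
    rw [div_le_div_iff₀ (by positivity) hκ₀]
    have h1 : 2 * Mφ * Mφ' * (α * η) * (mc - 2 * (d : ℝ) * η⁻¹ ^ 2 * (Real.cosh (κ₀ * η) - 1)) ≤ 2 * Mφ * Mφ' * (α * η) * mc :=
      mul_le_mul_of_nonneg_left hm''le (by positivity)
    have h2 : Mφ * Mφ' * α * mc * (2 * (κ₀ * η)) ≤ Mφ * Mφ' * α * mc * (2 * Real.sinh (κ₀ * η)) :=
      mul_le_mul_of_nonneg_left (by linarith) (by positivity)
    calc 2 * Mφ * Mφ' * (α * η) * (mc - 2 * (d : ℝ) * η⁻¹ ^ 2 * (Real.cosh (κ₀ * η) - 1)) * κ₀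
        ≤ 2 * Mφ * Mφ' * (α * η) * mc * κ₀ := mul_le_mul_of_nonneg_right h1 hκ₀.le
      _ = Mφ * Mφ' * α * mc * (2 * (κ₀ * η)) := by ring
      _ ≤ Mφ * Mφ' * α * mc * (2 * Real.sinh (κ₀ * η)) := h2
  have htBC := (htB bnd.2).trans hCle
  rw [hnorm] at htBC
  have hexp : 2 * Real.exp (κ₀ * η * ((L : ℝ) ^ (n + 1) - 1)) ≤ 2 * Real.exp κ₀ := by
    have h : κ₀ * η * ((L : ℝ) ^ (n + 1) - 1) ≤ κ₀ := by
      have e : κ₀ * η * ((L : ℝ) ^ (n + 1) - 1) = κ₀ * η * (L : ℝ) ^ (n + 1) - κ₀ * η := by ring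
      rw [e, haL]; linarith
    linarith [Real.exp_le_exp.mpr h]
  -- assemble
  have hBC0 : 0 ≤ (fun ν : Fin d => (1 + Real.exp (-(κ₀ * η))) *
        ((1 + 2 * η⁻¹ / (towerP L m (n + 1) ν * Real.sqrt (mc - 2 * ((d : ℝ) - 1) * η⁻¹ ^ 2 * (Real.cosh (κ₀ * η) - 1)))) /
          Real.sqrt ((mc - 2 * ((d : ℝ) - 1) * η⁻¹ ^ 2 * (Real.cosh (κ₀ * η) - 1)) ^ 2 +
            4 * (mc - 2 * ((d : ℝ) - 1) * η⁻¹ ^ 2 * (Real.cosh (κ₀ * η) - 1)) * η⁻¹ ^ 2)) +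
        2 * Real.sinh (κ₀ * η) / (mc - 2 * (d : ℝ) * η⁻¹ ^ 2 * (Real.cosh (κ₀ * η) - 1))) bnd.2 := hβ.le.trans (hβB bnd.2)
  have htB0 := mul_nonneg ht0.le hBC0
  have hY : 0 ≤ 1 + (|a'| + mc) * Cu + (d : ℝ) * (2 * Mφ * Mφ' * α' + (2 * Mφ * Mφ' * α) * (2 * Mφ * Mφ' * α)) * Cu +
      (Mφ * Mφ' * α * mc / κ₀) * Cu := by positivity
  have hX0 : 0 ≤ 2 * (η⁻¹ * ((1 + (|a'| + mc) * Cu) +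
        (d : ℝ) * (2 * Mφ * Mφ' * α' + (2 * Mφ * Mφ' * α) * (2 * Mφ * Mφ' * α)) * Cu) +
        η⁻¹ * (2 * Mφ * Mφ' * (α * η)) / (2 * Real.sinh (κ₀ * η) / (mc - 2 * (d : ℝ) * η⁻¹ ^ 2 * (Real.cosh (κ₀ * η) - 1))) * Cu) *
      (fun ν : Fin d => (1 + Real.exp (-(κ₀ * η))) *
        ((1 + 2 * η⁻¹ / (towerP L m (n + 1) ν * Real.sqrt (mc - 2 * ((d : ℝ) - 1) * η⁻¹ ^ 2 * (Real.cosh (κ₀ * η) - 1)))) /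
          Real.sqrt ((mc - 2 * ((d : ℝ) - 1) * η⁻¹ ^ 2 * (Real.cosh (κ₀ * η) - 1)) ^ 2 +
            4 * (mc - 2 * ((d : ℝ) - 1) * η⁻¹ ^ 2 * (Real.cosh (κ₀ * η) - 1)) * η⁻¹ ^ 2)) +
        2 * Real.sinh (κ₀ * η) / (mc - 2 * (d : ℝ) * η⁻¹ ^ 2 * (Real.cosh (κ₀ * η) - 1))) bnd.2 := by
    refine mul_nonneg (mul_nonneg (by norm_num) (add_nonneg (by positivity) ?_)) hBC0
    have : 0 ≤ η⁻¹ * (2 * Mφ * Mφ' * (α * η)) / (2 * Real.sinh (κ₀ * η) / (mc - 2 * (d : ℝ) * η⁻¹ ^ 2 * (Real.cosh (κ₀ * η) - 1))) :=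
      div_nonneg (by positivity) hβ.le
    exact mul_nonneg this hCu
  refine hmain.trans ?_
  rw [hnorm, hnmc, habs, e2, e4]
  exact assemble_le hexp (bracket_le le_rfl hδβ hCu htBC htB0 hY) hX0 (by positivity) hF (Real.exp_pos _).le

end Diagonal

end Literature.MathematicalPhysics.QuantumFieldTheory.Balaban1983to89.B9Eq342GreenPrimeTowerGradientRowDiagonal

end
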